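import Mathlib
import Summits.Ventures.PercRepro2.SwOutMixedPartDefs
import Summits.Ventures.PercRepro2.SwOutMixedArmsBaseDefs
import Summits.Ventures.PercRepro2.SwOutMixedArmsPlusBlock

/-!
# The junction with several dropped vertices: vocabulary (blind cell PercRepro2, night-4 g22,
2026-08-27; proofs/NIGHT4-G22.md §1)

THE SEVERAL-ARMS JUNCTION (H1_sev) at `(u, p)` (`MixedJunctionR`): the junction `u ∈ U ∖ {h, o}`
(no loop, not adjacent to `h`) and the DROPPED VERTICES `p r ∈ U ∖ {h, o, u}` (`r : ρ`, `p`
injective), each adjacent to `u`, not adjacent to `h`, without a loop; (a) every neighbour of `u`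
other than the `p r` is adjacent to `h`; (b) every neighbour of `p r` inside `U` other than `u` is
adjacent to `h`; (d) the component of `p r` in `G[U ∖ {h, u}]` contains no neighbour of `u` other
than `p r`; and every other vertex of `U ∖ {h, o}` carries an outside edge or no edge.  A dropped
vertex without a neighbour inside `U` other than `u` is a PURE arm; the single mixed junction
`MixedJunction` is the case `ρ = Unit` with (e).

For a configuration `ζ` the arm of `p r` is `armC ζ (p r)` with the h-piece
`AhOfR ζ r = armC ζ (p r) ∖ {p r}`; the other arms are the u-arms (`uArmsR`, adjacent to `u`)
and the far arms (`farArmsR`).  THE DICHOTOMY PER ARM at the canonical base: the arm `r` is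
MIXED when every dead edge (`p r`–`AhOfR ζ r`) is blue at `coreBaseOf ζ` (`DeadBlueR`), and
ABSORBED otherwise.  The PIECES of a mixed arm are the components of `G[AhOfR ζ r]` (`pieceC`,
one per dead edge, `piecesR`); an absorbed arm is re-typed as a u-arm (`absArmsR`).  The data of
a core-kind point (`mixedDataR`) and the block of a data record (`blockR`, the block
`blockCRP` of the several-arms base built from the data) are defined here; that the canonical
base is a `MixedBaseR` on these data is the next file.
-/

namespace Summit.Ventures.PercRepro2

namespace MixedArms

open Hull LocRows BigBlock

variable {V : Type*} {E : Type*} [Fintype E] [DecidableEq E]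

open scoped Classical

variable {ends : E → Sym2 V}

section Vocabulary

variable (ends) {ρ : Type*} [Fintype ρ] (h u : V) (p : ρ → V)

/-- The h-piece of the arm of `p r`: the arm of `p r` without `p r`. -/
noncomputable def AhOfR (ζ : Config E) (r : ρ) : Set V := armC ends h u ζ (p r) \ {p r}

/-- The u-arms: the arms other than the arms of the dropped vertices that are adjacent to `u`. -/
noncomputable def uArmsR (ζ : Config E) : Finset (Set V) :=
  (armsC ends h u ζ).filter fun P => (∀ r, P ≠ armC ends h u ζ (p r)) ∧ ∃ e x, ends e = s(u, x) ∧ x ∈ P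

/-- The far arms: the arms other than the arms of the dropped vertices not adjacent to `u`. -/
noncomputable def farArmsR (ζ : Config E) : Finset (Set V) :=
  (armsC ends h u ζ).filter fun P =>
    (∀ r, P ≠ armC ends h u ζ (p r)) ∧ ¬ ∃ e x, ends e = s(u, x) ∧ x ∈ P

/-- The arm `r` is MIXED: every dead edge of `p r` is blue at the canonical base. -/
def DeadBlueR (ζ : Config E) (r : ρ) : Prop :=
  ∀ e x, ends e = s(p r, x) → x ∈ AhOfR ends h u p ζ r → coreBaseOf ends ζ h u e = false

/-- The mixed arms. -/
noncomputable def mixedR (ζ : Config E) : Finset ρ :=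
  Finset.univ.filter fun r => DeadBlueR ends h u p ζ r

/-- The piece of `x` in the h-piece of the arm `r`: its component in `G[AhOfR ζ r]`. -/
noncomputable def pieceC (ζ : Config E) (r : ρ) (x : V) : Set V :=
  cluster ends (fun e => decide (e ∈ within ends (AhOfR ends h u p ζ r))) x

/-- The dead edges of the arm `r`: the edges from `p r` into its h-piece. -/
noncomputable def deadEdgesR (ζ : Config E) (r : ρ) : Finset E :=
  Finset.univ.filter fun e => ∃ y, ends e = s(p r, y) ∧ y ∈ AhOfR ends h u p ζ r

/-- The piece at the far end of a dead edge. -/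
def pieceOfEdgeR (ζ : Config E) (r : ρ) (e : E) : Set V :=
  {v | ∃ y, ends e = s(p r, y) ∧ y ∈ AhOfR ends h u p ζ r ∧ v ∈ pieceC ends h u p ζ r y}

/-- The pieces of the mixed arms, tagged by their arm. -/
noncomputable def piecesR (ζ : Config E) : Finset (ρ × Set V) :=
  (mixedR ends h u p ζ).biUnion fun r =>
    (deadEdgesR ends h u p ζ r).image fun e => (r, pieceOfEdgeR ends h u p ζ r e)

/-- The absorbed arms (a red dead edge at the canonical base), tagged by their arm. -/
noncomputable def absArmsR (ζ : Config E) : Finset (ρ × Set V) :=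
  (Finset.univ.filter fun r => ¬ DeadBlueR ends h u p ζ r).image fun r => (r, armC ends h u ζ (p r))

/-- **The data of a core-kind point**: the canonical base, the u-arms, the mixed arms, the pieces,
the absorbed arms, the far arms. -/
structure DataR (V E ρ : Type*) where
  /-- the base -/
  base : Config E
  /-- the u-arms -/
  uArms : Finset (Set V)
  /-- the mixed arms -/
  mixed : Finset ρ
  /-- the pieces of the mixed arms -/
  pieces : Finset (ρ × Set V)
  /-- the absorbed arms -/
  abs : Finset (ρ × Set V)
  /-- the far arms -/
  far : Finset (Set V)

/-- The data read off a core-kind point. -/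
noncomputable def mixedDataR (ζ : Config E) : DataR V E ρ :=
  ⟨coreBaseOf ends ζ h u, uArmsR ends h u p ζ, mixedR ends h u p ζ, piecesR ends h u p ζ,
    absArmsR ends h u p ζ, farArmsR ends h u p ζ⟩

/-- The u-arm index of a data record: the u-arms and the absorbed arms. -/
abbrev DataR.ι (d : DataR V E ρ) : Type _ := {P // P ∈ d.uArms} ⊕ {x // x ∈ d.abs}

/-- The u-arms of a data record. -/
def DataR.U (d : DataR V E ρ) : d.ι → Set V := Sum.elim (fun P => P.1) fun x => x.1.2

/-- The mixed-arm index of a data record. -/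
abbrev DataR.ρ' (d : DataR V E ρ) : Type _ := {r // r ∈ d.mixed}

/-- The piece index of a data record: the pieces whose arm is mixed. -/
abbrev DataR.ν (d : DataR V E ρ) : Type _ := {x // x ∈ d.pieces.filter fun x => x.1 ∈ d.mixed}

/-- The pieces of a data record. -/
def DataR.Ah (d : DataR V E ρ) : d.ν → Set V := fun x => x.1.2

/-- The arm of a piece. -/
def DataR.arm (d : DataR V E ρ) : d.ν → d.ρ' := fun x => ⟨x.1.1, (Finset.mem_filter.1 x.2).2⟩

/-- The far-arm index of a data record. -/
abbrev DataR.κ (d : DataR V E ρ) : Type _ := {P // P ∈ d.far}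

/-- The far arms of a data record. -/
def DataR.F (d : DataR V E ρ) : d.κ → Set V := fun P => P.1

/-- The dropped vertices of the mixed arms. -/
def DataR.drop (d : DataR V E ρ) : d.ρ' → V := fun r => p r.1

/-- **The block of a data record**: the realisations of the non-leaking points of the raw cube of
the several-arms base built from the data. -/
noncomputable def blockR (d : DataR V E ρ) : Finset (Config E) :=
  blockCRP ends d.base u d.U (d.drop p) d.Ah d.arm d.F

/-- **The several-arms junction (H1_sev)**: the junction `u` and the dropped vertices `p r`. -/
structure MixedJunctionR (ends : E → Sym2 V) (U : Set V) (h u : V) (p : ρ → V) (o : V) :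
    Prop where
  hne_hu : h ≠ u
  hne_hp : ∀ r, h ≠ p r
  hne_up : ∀ r, u ≠ p r
  p_inj : Function.Injective p
  hou : o ≠ u
  hop : ∀ r, o ≠ p r
  hloop_h : ∀ e, ends e ≠ s(h, h)
  hloop_u : ∀ e, ends e ≠ s(u, u)
  hloop_p : ∀ r e, ends e ≠ s(p r, p r)
  hnadj : ∀ e, ends e ≠ s(h, u)
  hnadj_p : ∀ r e, ends e ≠ s(h, p r)
  hup : ∀ r, ∃ e, ends e = s(u, p r)
  /-- (a) every neighbour of `u` other than the dropped vertices is adjacent to `h`. -/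
  hu_adj_h : ∀ e x, ends e = s(u, x) → (∀ r, x ≠ p r) → ∃ e', ends e' = s(x, h)
  /-- (b) every neighbour of `p r` inside `U` other than `u` is adjacent to `h`. -/
  hp_adj_h : ∀ r e x, ends e = s(p r, x) → x ∈ U → x ≠ u → ∃ e', ends e' = s(x, h)
  /-- (d) the component of `p r` in `G[U ∖ {h, u}]` has no neighbour of `u` other than `p r`. -/
  hcomp : ∀ r, ∀ x ∈ compU ends U h u (p r), x ≠ p r → ∀ e, ends e ≠ s(u, x)
  hout : ∀ x ∈ U, x ≠ h → x ≠ o → x ≠ u →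
    (∃ e y, ends e = s(x, y) ∧ y ∉ U) ∨ (∀ e, x ∉ ends e)

end Vocabulary

section Basic

variable {ρ : Type*} [Fintype ρ] {U : Set V} {h u o : V} {p : ρ → V}

omit [DecidableEq E] in
/-- A u-arm is an arm other than the arms of the dropped vertices, adjacent to `u`. -/
lemma mem_uArmsR_iff {ζ : Config E} {P : Set V} :
    P ∈ uArmsR ends h u p ζ ↔
      P ∈ armsC ends h u ζ ∧ (∀ r, P ≠ armC ends h u ζ (p r)) ∧ ∃ e x, ends e = s(u, x) ∧ x ∈ P := by
  simp only [uArmsR, Finset.mem_filter]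

omit [DecidableEq E] in
/-- A far arm is an arm other than the arms of the dropped vertices, not adjacent to `u`. -/
lemma mem_farArmsR_iff {ζ : Config E} {P : Set V} :
    P ∈ farArmsR ends h u p ζ ↔
      P ∈ armsC ends h u ζ ∧ (∀ r, P ≠ armC ends h u ζ (p r)) ∧
        ¬ ∃ e x, ends e = s(u, x) ∧ x ∈ P := by
  simp only [farArmsR, Finset.mem_filter]

omit [Fintype E] [DecidableEq E] in
/-- Membership in the mixed arms. -/
lemma mem_mixedR_iff {ζ : Config E} {r : ρ} :
    r ∈ mixedR ends h u p ζ ↔ DeadBlueR ends h u p ζ r := by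
  simp only [mixedR, Finset.mem_filter, Finset.mem_univ, true_and]

omit [DecidableEq E] [Fintype ρ] in
/-- Membership in the dead edges. -/
lemma mem_deadEdgesR_iff {ζ : Config E} {r : ρ} {e : E} :
    e ∈ deadEdgesR ends h u p ζ r ↔ ∃ y, ends e = s(p r, y) ∧ y ∈ AhOfR ends h u p ζ r := by
  simp only [deadEdgesR, Finset.mem_filter, Finset.mem_univ, true_and]

omit [DecidableEq E] in
/-- Membership in the pieces. -/
lemma mem_piecesR_iff {ζ : Config E} {x : ρ × Set V} :
    x ∈ piecesR ends h u p ζ ↔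
      DeadBlueR ends h u p ζ x.1 ∧ ∃ e ∈ deadEdgesR ends h u p ζ x.1,
        x.2 = pieceOfEdgeR ends h u p ζ x.1 e := by
  simp only [piecesR, Finset.mem_biUnion, Finset.mem_image, mem_mixedR_iff]
  constructor
  · rintro ⟨r, hr, e, he, rfl⟩
    exact ⟨hr, e, he, rfl⟩
  · rintro ⟨hr, e, he, hx⟩
    exact ⟨x.1, hr, e, he, Prod.ext rfl hx.symm⟩

omit [Fintype E] [DecidableEq E] in
/-- Membership in the absorbed arms. -/
lemma mem_absArmsR_iff {ζ : Config E} {x : ρ × Set V} :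
    x ∈ absArmsR ends h u p ζ ↔ ¬ DeadBlueR ends h u p ζ x.1 ∧ x.2 = armC ends h u ζ (p x.1) := by
  simp only [absArmsR, Finset.mem_image, Finset.mem_filter, Finset.mem_univ, true_and]
  constructor
  · rintro ⟨r, hr, rfl⟩
    exact ⟨hr, rfl⟩
  · rintro ⟨hr, hx⟩
    exact ⟨x.1, hr, Prod.ext rfl hx.symm⟩

variable (hj : MixedJunctionR ends U h u p o)
include hj

omit [DecidableEq E] [Fintype ρ] in
/-- The arm of a dropped vertex is an arm. -/
lemma armP_mem_armsC_R (ζ : Config E) (r : ρ) : armC ends h u ζ (p r) ∈ armsC ends h u ζ := by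
  obtain ⟨e, he⟩ := hj.hup r
  exact armC_mem_armsC hj.hne_hu (p_mem_extHull (hj.hup r) ζ) (hj.hne_hp r).symm
    (hj.hne_up r).symm (Or.inr he)

omit [Fintype E] [DecidableEq E] [Fintype ρ] in
/-- No u-edge enters the arm of `p r` except at `p r` (when `H⁺ ⊆ U`). -/
lemma eq_p_of_u_edge_R {ζ : Config E} (hHU : extHull ends ζ h u ⊆ U) (r : ρ) {e : E} {x : V}
    (he : ends e = s(u, x)) (hx : x ∈ armC ends h u ζ (p r)) : x = p r := by
  by_contra hxp
  exact hj.hcomp r x (armC_subset_compU hHU (p r) hx) hxp e he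

omit [Fintype E] [DecidableEq E] [Fintype ρ] in
/-- The arms of two distinct dropped vertices are distinct (when `H⁺ ⊆ U`). -/
lemma armP_ne_R {ζ : Config E} (hHU : extHull ends ζ h u ⊆ U) {r r' : ρ} (hrr : r ≠ r') :
    armC ends h u ζ (p r) ≠ armC ends h u ζ (p r') := by
  intro heq
  have hmem : p r' ∈ armC ends h u ζ (p r) := heq ▸ mem_armC_self (p r')
  obtain ⟨e, he⟩ := hj.hup r'
  exact hrr (hj.p_inj (eq_p_of_u_edge_R hj hHU r he hmem)).symm

omit [DecidableEq E] in
/-- A vertex of `H⁺ ∖ {h, u}` lies in an h-piece, is a dropped vertex, or lies in a u-arm or a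
far arm. -/
lemma arm_cases_R {ζ : Config E} {x : V} (hxH : x ∈ extHull ends ζ h u) (hxh : x ≠ h)
    (hxu : x ≠ u) :
    (∃ r, x ∈ AhOfR ends h u p ζ r) ∨ (∃ r, x = p r) ∨ (∃ P ∈ uArmsR ends h u p ζ, x ∈ P) ∨
      ∃ P ∈ farArmsR ends h u p ζ, x ∈ P := by
  obtain ⟨P, hP, hxP⟩ := exists_armsC_of_mem hj.hne_hu hxH hxh hxu
  by_cases hPp : ∃ r, P = armC ends h u ζ (p r)
  · obtain ⟨r, rfl⟩ := hPp
    by_cases hxp : x = p r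
    · exact Or.inr (Or.inl ⟨r, hxp⟩)
    · exact Or.inl ⟨r, hxP, hxp⟩
  have hPp' : ∀ r, P ≠ armC ends h u ζ (p r) := fun r hr => hPp ⟨r, hr⟩
  by_cases hadj : ∃ e y, ends e = s(u, y) ∧ y ∈ P
  · exact Or.inr (Or.inr (Or.inl ⟨P, mem_uArmsR_iff.2 ⟨hP, hPp', hadj⟩, hxP⟩))
  · exact Or.inr (Or.inr (Or.inr ⟨P, mem_farArmsR_iff.2 ⟨hP, hPp', hadj⟩, hxP⟩))

omit [Fintype E] [DecidableEq E] [Fintype ρ] in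
/-- A dropped vertex has an edge to the outside of `U`. -/
lemma exists_ext_edge_R (hU : ∀ r, p r ∈ U) (r : ρ) : ∃ e y, ends e = s(p r, y) ∧ y ∉ U := by
  rcases hj.hout (p r) (hU r) (hj.hne_hp r).symm (hj.hop r).symm (hj.hne_up r).symm with h' | h'
  · exact h'
  · exfalso
    obtain ⟨e, he⟩ := hj.hup r
    exact h' e (by rw [he]; exact Sym2.mem_mk_right _ _)

end Basic

end MixedArms

end Summit.Ventures.PercRepro2
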